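import Summits.HubbardSuperconductivity.HubbardSuperconductivity.Theses.LiebTwin
import Literature.MathematicalPhysics.QuantumLattice.HubbardWave0LiebProofs
import Literature.MathematicalPhysics.QuantumLattice.LiebSpinReflection
import HarnessLib

/-!
# Route `LiebTwin`, support `RectificationRaisesEnergy` (item `stmt-HubbardSuperconductivity-15661`)

Closes `Summit.HubbardSuperconductivity.HubbardSuperconductivity.Theses.LiebTwin.RectificationRaisesEnergy`:
for `0 ≤ U`, every real `φ` in the `(n, n)` sector of the fermionic torus `(ℤ/Lℤ)²` whose Lieb matrix
`W = liebW n φ` is symmetric has a TWIN `φ̃ = liebVec n |W|`, `|W| = CFC.abs W = (WᴴW)^{1/2}`, with the same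
norm, `⟨φ̃, φ̃⟩ = ⟨φ, φ⟩`, and no smaller repulsive energy, `Re⟨φ, Hφ⟩ ≤ Re⟨φ̃, Hφ̃⟩`, `H = hubbardTorus 2 L 1 U`.

Proof (Lieb, PRL 62 (1989) 1201, proof of Theorem 1, eq. (3) and the displayed trace inequality, with the
sign of `U` reversed). The transfer `ψ ↦ W(ψ)` is unitary on the sector (`LiebThm1.hsInner_liebW`) and
intertwines `H` with `𝓗 W = KW + WK + U Σ_x L_x W L_x` (`LiebThm1.liebW_hamiltonian_mulVec`), so
`⟨ψ, Hψ⟩ = ⟨W, 𝓗 W⟩_HS`. Norm: `|W|ᴴ|W| = |W|² = WᴴW` (`CFC.abs_nonneg`, `CFC.abs_mul_abs`), so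
`Tr |W|ᴴ|W| = Tr WᴴW` — no hypothesis on `W` is needed. Energy: `φ` real and `Wᵀ = W` make `W` Hermitian,
`W = V D_w Vᴴ` (spectral theorem) and `|W| = V D_{|w|} Vᴴ` (`CFC.abs_eq_cfc_norm`, `Matrix.IsHermitian.cfc_eq`);
by eq. (3), `⟨W, 𝓗 W⟩ = 2 Tr K W² + U Σ_x Tr (W L_x W L_x)` (`hsInner_liebOp_of_conjTranspose_eq`), where
`|W|² = W²` (`unitConj_abs_mul_self`) and `Tr W L_x W L_x ≤ Tr |W| L_x |W| L_x` (`re_trace_unitConj_mul_le`);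
with `0 ≤ U` the energy can only go up. No definition and no named fact is introduced.
-/

-- the mandated namespace `Summit.<Summit>.<Problem>.Theorems` repeats `HubbardSuperconductivity`
-- (single-problem summit, D-0017), which the `dupNamespace` linter flags on every declaration
set_option linter.dupNamespace false

noncomputable section

namespace Summit.HubbardSuperconductivity.HubbardSuperconductivity.Theorems

open Matrix Literature.MathematicalPhysics.QuantumLattice
open scoped ComplexOrder MatrixOrder Matrix.Norms.L2Operator

/-! ### Matrix side: the absolute value of a Hermitian matrix and Lieb's energy comparison -/

section MatrixSide

variable {A X : Type*} [Fintype A] [DecidableEq A] [Fintype X]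

/-- **`Tr |W|ᴴ |W| = Tr Wᴴ W`** for every square matrix `W`, `|W| = CFC.abs W = (WᴴW)^{1/2}`: `|W|` is
self-adjoint (`CFC.abs_nonneg`) and `|W| |W| = Wᴴ W` (`CFC.abs_mul_abs`). Lieb, PRL 62 (1989) 1201, proof of
Theorem 1 ("Obviously, `Tr W² = Tr |W|²`"). [cite: LiebPRL1989, proof of Theorem 1] -/
theorem hsInner_cfcAbs_self (W : Matrix A A ℂ) :
    hsInner (CFC.abs W) (CFC.abs W) = hsInner W W := by
  have hsa : (CFC.abs W)ᴴ = CFC.abs W := (CFC.abs_nonneg W).isSelfAdjoint.star_eq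
  rw [hsInner, hsInner, hsa, CFC.abs_mul_abs, star_eq_conjTranspose]

/-- **`|W| = V D_{|w|} Vᴴ`** for a Hermitian `W = V D_w Vᴴ` (`V` the eigenvector unitary, `w` the
eigenvalues): the continuous-functional-calculus absolute value of a Hermitian matrix is Lieb's `|W|`
("in an orthonormal basis in which `W` is diagonal, with diagonal elements `w_i`, `|W|` is also diagonal
with elements `|w_i|`"). Lieb, PRL 62 (1989) 1201, proof of Theorem 1. [cite: LiebPRL1989, proof of Theorem 1] -/
theorem cfcAbs_eq_unitConj {W : Matrix A A ℂ} (hW : W.IsHermitian) :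
    CFC.abs W = unitConj (hW.eigenvectorUnitary : Matrix A A ℂ) |hW.eigenvalues| := by
  rw [CFC.abs_eq_cfc_norm W hW.isSelfAdjoint, hW.cfc_eq, Matrix.IsHermitian.cfc,
    Unitary.conjStarAlgAut_apply, star_eq_conjTranspose, unitConj]
  -- the two diagonals agree definitionally (`‖w‖ = |w|` on `ℝ`)
  congr 2

/-- The spectral decomposition `W = V D_w Vᴴ` of a Hermitian matrix in the notation `unitConj`.
Lieb, PRL 62 (1989) 1201, proof of Theorem 1. [cite: LiebPRL1989, proof of Theorem 1] -/
theorem eq_unitConj_eigenvalues {W : Matrix A A ℂ} (hW : W.IsHermitian) :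
    W = unitConj (hW.eigenvectorUnitary : Matrix A A ℂ) hW.eigenvalues := by
  conv_lhs => rw [hW.spectral_theorem]
  rw [Unitary.conjStarAlgAut_apply, star_eq_conjTranspose]
  rfl

/-- **Rectification raises the repulsive energy (matrix form).** For Hermitian `L_x`, `0 ≤ U` and a
Hermitian `W`: `Re ⟨W, 𝓗 W⟩ ≤ Re ⟨|W|, 𝓗 |W|⟩`, `𝓗 W = KW + WK + U Σ_x L_x W L_x`. By Lieb's eq. (3),
`⟨W, 𝓗 W⟩ = 2 Tr K W² + U Σ_x Tr (W L_x W L_x)` with `|W|² = W²` and `Tr W L_x W L_x ≤ Tr |W| L_x |W| L_x`; for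
`U ≥ 0` the interaction term can only grow (the sign-reversed form of "Since `U_x ≤ 0`, I conclude that
`E(W) ≥ E(|W|)`"). Lieb, PRL 62 (1989) 1201, eq. (3) and proof of Theorem 1. [cite: LiebPRL1989, eq. (3)] -/
theorem re_hsInner_liebOp_le_cfcAbs (K : Matrix A A ℂ) {L : X → Matrix A A ℂ} (hL : ∀ x, (L x)ᴴ = L x)
    {U : ℝ} (hU : 0 ≤ U) {W : Matrix A A ℂ} (hW : W.IsHermitian) :
    (hsInner W (liebOp K L U W)).re ≤ (hsInner (CFC.abs W) (liebOp K L U (CFC.abs W))).re := by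
  set V : Matrix A A ℂ := (hW.eigenvectorUnitary : Matrix A A ℂ) with hVdef
  set f : A → ℝ := hW.eigenvalues with hf
  have hV : Vᴴ * V = 1 := by
    rw [← star_eq_conjTranspose]
    exact Unitary.coe_star_mul_self hW.eigenvectorUnitary
  have habs : CFC.abs W = unitConj V |f| := cfcAbs_eq_unitConj hW
  have hWeq : W = unitConj V f := eq_unitConj_eigenvalues hW
  rw [habs]
  conv_lhs => rw [hWeq]
  rw [hsInner_liebOp_of_conjTranspose_eq (unitConj_conjTranspose V |f|),
    hsInner_liebOp_of_conjTranspose_eq (unitConj_conjTranspose V f),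
    unitConj_abs_mul_self V (hV := hV) f]
  simp only [Complex.add_re, Complex.re_ofReal_mul, Complex.re_sum, add_le_add_iff_left]
  refine mul_le_mul_of_nonneg_left (Finset.sum_le_sum fun x _ => ?_) hU
  exact re_trace_unitConj_mul_le V f (hL x)

end MatrixSide

/-! ### Fock side: the transfer `ψ ↦ W(ψ)` -/

section FockSide

variable {Λ : Type*} [LinearOrder Λ] [Fintype Λ]

/-- A real wave function with symmetric Lieb matrix has a Hermitian Lieb matrix: the entries
`W_{αβ} = σ(α,β) φ(α↑ ∪ β↓)` are real (`σ` is a sign), so `Wᴴ = Wᵀ = W` (Lieb: "with `W` Hermitian").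
Lieb, PRL 62 (1989) 1201, proof of Theorem 1. [cite: LiebPRL1989, proof of Theorem 1] -/
theorem isHermitian_liebW_of_real {n : ℕ} {φ : Fock (Orb Λ)} (hreal : ∀ s, star (φ s) = φ s)
    (hsym : (liebW n φ)ᵀ = liebW n φ) : (liebW n φ).IsHermitian := by
  have hstar : ∀ α β : Config Λ n, star (liebW n φ α β) = liebW n φ α β := by
    intro α β
    rw [liebW_apply, star_mul', LiebThm1.star_pairSign, hreal]
  ext α β
  rw [conjTranspose_apply, hstar, ← transpose_apply (liebW n φ) α β, hsym]

variable [DecidableEq Λ]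

/-- **The twin has the norm of `φ`**: `⟨φ̃, φ̃⟩ = ⟨φ, φ⟩` for `φ̃ = liebVec n |liebW n φ|` and every `φ`
in the `(n, n)` sector (`ψ ↦ W(ψ)` is unitary on the sector and `Tr |W|ᴴ|W| = Tr WᴴW`).
Lieb, PRL 62 (1989) 1201, proof of Theorem 1 ("`Tr W² = Tr |W|²`"). [cite: LiebPRL1989, proof of Theorem 1] -/
theorem star_twin_dotProduct_twin {n : ℕ} {φ : Fock (Orb Λ)} (hφ : IsInSector n n φ) :
    star (liebVec n (CFC.abs (liebW n φ))) ⬝ᵥ liebVec n (CFC.abs (liebW n φ)) = star φ ⬝ᵥ φ := by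
  rw [← LiebThm1.hsInner_liebW (isInSector_liebVec n _), LiebThm1.liebW_liebVec, hsInner_cfcAbs_self,
    LiebThm1.hsInner_liebW hφ]

variable (G : SimpleGraph Λ) [DecidableRel G.Adj]

omit [DecidableEq Λ] in
/-- **Energy in Lieb coordinates**: `⟨ψ, H ψ⟩ = ⟨W(ψ), 𝓗 W(ψ)⟩_HS` for `ψ` in the `(n, n)` sector,
`H = hamiltonian G t U`, `𝓗 = liebOp (liebK G t n) (liebL n) U` (unitarity of the transfer and Lieb's
eq. (4)). Lieb, PRL 62 (1989) 1201, eqs. (3)–(4). [cite: LiebPRL1989, eqs. (3)–(4)] -/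
theorem expect_hamiltonian_eq_hsInner_liebOp (t U : ℝ) {n : ℕ} {ψ : Fock (Orb Λ)}
    (hψ : IsInSector n n ψ) :
    expect (hamiltonian G t U) ψ = hsInner (liebW n ψ) (liebOp (liebK G t n) (liebL n) U (liebW n ψ)) := by
  rw [expect, ← LiebThm1.hsInner_liebW hψ, LiebThm1.liebW_hamiltonian_mulVec]

/-- **Rectification raises the repulsive energy (any graph).** For `0 ≤ U` and a real `(n, n)`-sector `φ`
with symmetric Lieb matrix, the twin `φ̃ = liebVec n |liebW n φ|` has `Re⟨φ, Hφ⟩ ≤ Re⟨φ̃, Hφ̃⟩`,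
`H = hamiltonian G t U`. Lieb, PRL 62 (1989) 1201, eq. (3) and proof of Theorem 1 (sign of `U` reversed).
[cite: LiebPRL1989, eq. (3)] -/
theorem re_expect_hamiltonian_le_twin (t : ℝ) {U : ℝ} (hU : 0 ≤ U) {n : ℕ} {φ : Fock (Orb Λ)}
    (hreal : ∀ s, star (φ s) = φ s) (hφ : IsInSector n n φ) (hsym : (liebW n φ)ᵀ = liebW n φ) :
    (expect (hamiltonian G t U) φ).re ≤
      (expect (hamiltonian G t U) (liebVec n (CFC.abs (liebW n φ)))).re := by
  rw [expect_hamiltonian_eq_hsInner_liebOp G t U hφ,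
    expect_hamiltonian_eq_hsInner_liebOp G t U (isInSector_liebVec n _), LiebThm1.liebW_liebVec]
  exact re_hsInner_liebOp_le_cfcAbs (liebK G t n) (liebL_conjTranspose n) hU
    (isHermitian_liebW_of_real hreal hsym)

end FockSide

/-! ### The route item -/

/-- **Rectification never lowers the repulsive energy** (route `LiebTwin`, support
`RectificationRaisesEnergy`, item `stmt-HubbardSuperconductivity-15661`): for `0 ≤ U` and every real `φ` in
the `(n, n)` sector of the torus `(ℤ/Lℤ)²` with symmetric Lieb matrix `W = liebW n φ`, the twin
`φ̃ = liebVec n |W|` has `⟨φ̃, φ̃⟩ = ⟨φ, φ⟩` and `Re⟨φ, Hφ⟩ ≤ Re⟨φ̃, Hφ̃⟩`, `H = hubbardTorus 2 L 1 U`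
(Lieb's eq. (3) with `Tr W L W L ≤ Tr |W| L |W| L` and the sign of `U` reversed: the step of the attractive
proof that breaks in the repulsive model). Lieb, PRL 62 (1989) 1201, eq. (3) and proof of Theorem 1.
[cite: LiebPRL1989, eq. (3)] -/
theorem rectificationRaisesEnergy_proof :
    Summit.HubbardSuperconductivity.HubbardSuperconductivity.Theses.LiebTwin.RectificationRaisesEnergy := by
  intro U hU L _ n φ hreal hφ hsym
  exact ⟨star_twin_dotProduct_twin hφ,
    re_expect_hamiltonian_le_twin (fermionTorusGraph 2 L) 1 hU hreal hφ hsym⟩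

end Summit.HubbardSuperconductivity.HubbardSuperconductivity.Theorems

end
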